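import Literature.Geometry.Kaehler.ComplexTorusThetaDivisorDecomposition
import Literature.Geometry.Kaehler.ComplexTorusIrreduciblePrincipallyPolarized
import Literature.Geometry.Kaehler.ComplexTorusKummerMapProduct
import Literature.Geometry.Kaehler.ComplexTorusThetaPullback
import Literature.Geometry.Kaehler.AnalyticSetProductIrreducible
import HarnessLib

/-!
# A principally polarised abelian variety is irreducible iff its theta divisor is irreducible
# (Clemens–Griffiths 1972, Cor. 3.23 (ii))

Layer `Literature/Geometry/Kaehler`, namespace `Literature.Geometry.Kaehler.ComplexTorus`; lane `lit-hodgefound` (Track 2 foundations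
library), skeleton seat `lit-hodgefound-skel-2` (generation 34), plan row A2-123 — row 3 (last) of the
programme «reducible theta divisors»: after A2-121 (`ComplexTorusPrincipalThetaDivisorReduced`: `Θ` is a
reduced hypersurface with `[Θ]_e = c₁(L)`) and A2-122 (`ComplexTorusThetaDivisorDecomposition`: `Θ`
reducible ⇒ `(X, H)` decomposable, Lange's Thm. 2.2.1 in the principal case), this file proves the
converse and assembles Clemens–Griffiths' Corollary 3.23 (ii) with p26's Definition 3.22
(`ComplexTorusIrreduciblePrincipallyPolarized`: `IsPolarizedIrreducible Φ η ↔ ¬ IsPolarizedDecomposable Φ η`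
for principally polarised tori). THEOREMS ONLY (no definition, no named fact, net debt `0`).

Sources followed. C. H. Clemens, P. A. Griffiths, *The intermediate Jacobian of the cubic threefold*,
Ann. of Math. **95** (1972), §3 p. 297 (held `paper:doi-10-2307-1970801` p0018), VERBATIM: "**Definition
3.22.** A principally polarized complex torus `𝒯` is irreducible if for any morphism `φ : 𝒯' → 𝒯` either
`𝒯' = 0` or `φ` is an isomorphism. Since the direct summands of `𝒯` in Lemma 3.20 were constructed
intrinsically from the components of `Θ(𝒯)`, we have: **Corollary 3.23.** If `𝒯` is a principally
polarized abelian variety, `𝒯` has a unique decomposition into the direct sum of irreducible principally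
polarized abelian varieties. `𝒯` itself is irreducible if and only if `Θ(𝒯)` is irreducible."
S. Grushevsky, *The Schottky problem*, MSRI Publ. **59** (2012) (held `paper:arxiv-1009.0369`), §1 p0004:
decomposable ppavs "are the ones for which the theta divisor is reducible"; §5 p0011: "for a decomposable
ppav `(A, Θ) = (A₁, Θ₁) × (A₂, Θ₂)` […] we have `Θ = (Θ₁ × A₂) ∪ (A₁ × Θ₂)`". H. Lange, *Abelian Varieties
over the Complex Numbers* (2023), §1.3.3 Lemma 1.3.6 (`f^* L(H, χ) = L(F^* H, F_Λ^* χ)`), §2.4.4 Cor. 2.4.24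
(products of polarized abelian varieties), §2.2.1 Thm. 2.2.1.

THE ARGUMENT FOR «DECOMPOSABLE ⇒ `Θ` REDUCIBLE». A product pair `(V, W)` of `(X, H)` (p16) gives the addition
isomorphism of polarised tori `h : (X_V × X_W, H|_V ⊞ H|_W) ⥲ (X, H)` (`IsProductPair.exists_isPolarizedIso_addition`)
with `ℂ`-linear analytic representation `C` (`IsPolarizedIso.exists_matrix`); both factors are principally
polarised (`IsPrincipalPolarization.isProductPair_iff_isPrincipalPolarization_restrict`, p26) of positive
dimension. The canonical theta function `ϑ` of `L(H, χ)` pulls back to a canonical theta function `ϑ ∘ C`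
of `L(C^*H, χ ∘ A) = L(H|_V ⊞ H|_W, ψ)` on `X_V × X_W` (Lemma 1.3.6: `comp_mem_thetaFunctions`,
`canonicalFactor_pullback`, p04), whose semicharacter splits as `ψ = ψ_V ⊠ ψ_W` (§1, the lattices being
`H`-orthogonal); by Künneth with `h⁰ = 1 · 1` (p04's `IsPrincipalPolarization.exists_eq_smul_boxMul`)
`ϑ ∘ C = a · ϑ_V ⊠ ϑ_W`, so `h⁻¹(Θ) = (Θ_V × X_W) ∪ (X_V × Θ_W)`, which is not irreducible (p04's
`not_isIrreducibleAnalyticSet_image_zeroSet_boxMul`), while irreducibility is invariant under biholomorphic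
maps (`IsIrreducibleAnalyticSet.preimage_homeomorph'`, A4 `AnalyticSetProductIrreducible`).

## Contents

* §1 `IsSemicharacter.inl`, `IsSemicharacter.inr`, **`IsSemicharacter.eq_boxProd`** — a semicharacter
  of a product datum `(Λ₁ ⊕ Λ₂, E₁ ⊞ E₂)` is the box product of its restrictions;
  `exists_thetaFunction_ne_zero_of_isPrincipalPolarization`.
* §2 **`IsPrincipalPolarization.not_isIrreducibleAnalyticSet_thetaDivisor_of_isPolarizedDecomposable`** —
  for `(X, H)` principally polarised and DECOMPOSABLE and any canonical theta function `ϑ ≢ 0` of `L(H, χ)`,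
  the theta divisor `Θ = π({ϑ = 0})` is NOT an irreducible analytic subset of `X` (any normed model `E`).
* §3 THE EQUIVALENCES (inner-product model, `dim X ≥ 1`):
  **`IsPrincipalPolarization.isPolarizedDecomposable_iff_not_isIrreducibleAnalyticSet_thetaDivisor`**
  (`(X, H)` decomposable ⟺ `Θ` reducible; «⇐» is A2-122, «⇒» is §2) and
  **`IsPrincipalPolarization.isPolarizedIrreducible_iff_isIrreducibleAnalyticSet_thetaDivisor`** —
  COR. 3.23 (ii): `𝒯` IS IRREDUCIBLE (Def. 3.22, p26's `IsPolarizedIrreducible`) IFF `Θ(𝒯)` IS IRREDUCIBLE.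

## References

* [ClemensGriffiths1972] C. H. Clemens, P. A. Griffiths, *The intermediate Jacobian of the cubic
  threefold*, Ann. of Math. 95 (1972), §3 Def. 3.22, Lemma 3.20, Cor. 3.23 (p. 297).
* [Grushevsky2012SchottkyProblem] S. Grushevsky, *The Schottky problem*, MSRI Publ. 59 (2012), §1, §5.
* [Lange2023AbelianVarietiesComplex] H. Lange, *Abelian Varieties over the Complex Numbers* (2023), §1.3.3
  Lemma 1.3.6, §2.2.1 Thm. 2.2.1, §2.4.4 Cor. 2.4.24, §3.1.2 Prop. 3.1.4.
* [Chirka1989] E. M. Chirka, *Complex Analytic Sets* (1989), §2.3, §5.3 (invariance of analyticity and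
  irreducibility under biholomorphic maps).
-/

noncomputable section

open scoped Manifold Topology ComplexOrder ContDiff
open Set Filter Function Module TopologicalSpace Complex

namespace Literature.Geometry.Kaehler

universe u

namespace ComplexTorus

/-! ### §1 Semicharacters of a product datum split -/

section Semicharacter

variable {ι₁ ι₂ : Type*} [Fintype ι₁] [Fintype ι₂] {E₁ E₂ : Type*} [NormedAddCommGroup E₁]
  [NormedSpace ℂ E₁] [NormedAddCommGroup E₂] [NormedSpace ℂ E₂]
  (Φ₁ : (ι₁ → ℝ) ≃L[ℝ] E₁) (Φ₂ : (ι₂ → ℝ) ≃L[ℝ] E₂) {ω₁ : E₁ [⋀^Fin 2]→L[ℝ] ℝ} {ω₂ : E₂ [⋀^Fin 2]→L[ℝ] ℝ}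
  {ψ : (ι₁ ⊕ ι₂ → ℤ) → ℂ}

omit [Fintype ι₁] [Fintype ι₂] in
/-- `(n₁ | 0) + (m₁ | 0) = (n₁ + m₁ | 0)` on `ℤ^{ι₁} ⊕ ℤ^{ι₂}`. [folklore] -/
private theorem sumElim_add_sumElim_zero_left (n m : ι₁ → ℤ) :
    Sum.elim n (0 : ι₂ → ℤ) + Sum.elim m (0 : ι₂ → ℤ) = Sum.elim (n + m) (0 : ι₂ → ℤ) := by
  funext k; cases k <;> simp

omit [Fintype ι₁] [Fintype ι₂] in
/-- `(0 | n₂) + (0 | m₂) = (0 | n₂ + m₂)`. [folklore] -/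
private theorem sumElim_zero_add_sumElim_right (n m : ι₂ → ℤ) :
    Sum.elim (0 : ι₁ → ℤ) n + Sum.elim (0 : ι₁ → ℤ) m = Sum.elim (0 : ι₁ → ℤ) (n + m) := by
  funext k; cases k <;> simp

/-- `ω(0, 0) = 0`. [folklore] -/
private theorem form_apply_zero_zero {F : Type*} [NormedAddCommGroup F] [NormedSpace ℝ F]
    (φ : F [⋀^Fin 2]→L[ℝ] ℝ) : φ ![(0 : F), 0] = 0 :=
  φ.map_coord_zero 0 rfl

/-- `ω(x, 0) = 0`. [folklore] -/
private theorem form_apply_left_zero {F : Type*} [NormedAddCommGroup F] [NormedSpace ℝ F]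
    (φ : F [⋀^Fin 2]→L[ℝ] ℝ) (x : F) : φ ![x, 0] = 0 :=
  φ.map_coord_zero 1 rfl

/-- `ω(0, y) = 0`. [folklore] -/
private theorem form_apply_zero_right {F : Type*} [NormedAddCommGroup F] [NormedSpace ℝ F]
    (φ : F [⋀^Fin 2]→L[ℝ] ℝ) (y : F) : φ ![0, y] = 0 :=
  φ.map_coord_zero 0 rfl

/-- **The restriction `ψ(· | 0)` of a semicharacter of `(Λ₁ ⊕ Λ₂, E₁ ⊞ E₂)` to `Λ₁` is a semicharacter for
`E₁`** (`(E₁ ⊞ E₂)((λ, 0), (μ, 0)) = E₁(λ, μ)`). [cite: Lange2023AbelianVarietiesComplex, §2.4.4 Cor. 2.4.24 and §1.3.1 (1.10)] -/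
theorem IsSemicharacter.inl (hψ : IsSemicharacter (prodPeriod Φ₁ Φ₂) (prodForm ω₁ ω₂) ψ) :
    IsSemicharacter Φ₁ ω₁ (fun n ↦ ψ (Sum.elim n 0)) where
  norm_eq_one n := hψ.norm_eq_one _
  map_add n m := by
    have h := hψ.map_add (Sum.elim n 0) (Sum.elim m 0)
    rw [sumElim_add_sumElim_zero_left, latticeVec_prodPeriod_sumElim_left,
      latticeVec_prodPeriod_sumElim_left, prodForm_apply] at h
    simpa [form_apply_zero_zero] using h

/-- **The restriction `ψ(0 | ·)` to `Λ₂` is a semicharacter for `E₂`.** [cite: Lange2023AbelianVarietiesComplex, §2.4.4 Cor. 2.4.24 and §1.3.1 (1.10)] -/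
theorem IsSemicharacter.inr (hψ : IsSemicharacter (prodPeriod Φ₁ Φ₂) (prodForm ω₁ ω₂) ψ) :
    IsSemicharacter Φ₂ ω₂ (fun n ↦ ψ (Sum.elim 0 n)) where
  norm_eq_one n := hψ.norm_eq_one _
  map_add n m := by
    have h := hψ.map_add (Sum.elim 0 n) (Sum.elim 0 m)
    rw [sumElim_zero_add_sumElim_right, latticeVec_prodPeriod_sumElim_right,
      latticeVec_prodPeriod_sumElim_right, prodForm_apply] at h
    simpa [form_apply_zero_zero] using h

/-- **A semicharacter of a product datum is the box product of its restrictions**: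
`ψ(λ₁, λ₂) = ψ(λ₁, 0) ψ(0, λ₂)`, because the summands `Λ₁ ⊕ 0`, `0 ⊕ Λ₂` are `(E₁ ⊞ E₂)`-orthogonal
(the defect `e(πi (E₁ ⊞ E₂)((λ₁,0),(0,λ₂))) = 1`). [cite: Lange2023AbelianVarietiesComplex, §2.4.4 Cor. 2.4.24 and §1.3.1 (1.10)] -/
theorem IsSemicharacter.eq_boxProd (hψ : IsSemicharacter (prodPeriod Φ₁ Φ₂) (prodForm ω₁ ω₂) ψ) :
    ψ = fun m ↦ ψ (Sum.elim (fun i ↦ m (Sum.inl i)) 0) * ψ (Sum.elim 0 (fun j ↦ m (Sum.inr j))) := by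
  funext m
  have hm : Sum.elim (fun i ↦ m (Sum.inl i)) (0 : ι₂ → ℤ) + Sum.elim (0 : ι₁ → ℤ) (fun j ↦ m (Sum.inr j)) =
      m := by
    funext k; cases k <;> simp
  have h := hψ.map_add (Sum.elim (fun i ↦ m (Sum.inl i)) 0) (Sum.elim 0 (fun j ↦ m (Sum.inr j)))
  rw [hm, latticeVec_prodPeriod_sumElim_left, latticeVec_prodPeriod_sumElim_right, prodForm_apply] at h
  simpa [form_apply_left_zero, form_apply_zero_right] using h

end Semicharacter

section Exists

variable {ι : Type*} [Fintype ι] [DecidableEq ι] {E : Type*} [NormedAddCommGroup E] [NormedSpace ℂ E]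
  [FiniteDimensional ℂ E] (Φ : (ι → ℝ) ≃L[ℝ] E) {η : E [⋀^Fin 2]→L[ℝ] ℝ} {χ : (ι → ℤ) → ℂ}

/-- **Every `L(H, χ)` with `H` principal has a canonical theta function `≢ 0`** (`h⁰ = 1 > 0`).
[cite: Lange2023AbelianVarietiesComplex, §1.5.3 Thm. 1.5.9 and §2.1.2 (p0077: "`h⁰(L) > 0`")] -/
theorem exists_thetaFunction_ne_zero_of_isPrincipalPolarization (hP : IsPrincipalPolarization Φ η)
    (hχ : IsSemicharacter Φ η χ) : ∃ ϑ ∈ thetaFunctions Φ (canonicalFactor Φ η χ), ∃ v, ϑ v ≠ 0 := by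
  haveI := finiteDimensional_canonicalThetaFunctions hP.isRiemannForm.isNSForm hχ
  have hpos : 0 < finrank ℂ (thetaFunctions Φ (canonicalFactor Φ η χ)) := by
    rw [finrank_thetaFunctions_eq_h0 (isFactor_canonicalFactor Φ hP.isRiemannForm.isNSForm hχ),
      hP.h0_lineBundleAH_eq_one hχ]
    exact one_pos
  obtain ⟨θ, hθ⟩ := Module.finrank_pos_iff_exists_ne_zero.1 hpos
  refine ⟨θ, θ.2, ?_⟩
  by_contra hall
  push Not at hall
  exact hθ (Subtype.ext (funext hall))

end Exists

/-! ### §2 A decomposable p.p.a.v. has a reducible theta divisor -/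

section Decomposable

variable {ι : Type*} [Fintype ι] [DecidableEq ι] {E : Type u} [NormedAddCommGroup E] [NormedSpace ℂ E]
  [FiniteDimensional ℂ E] (Φ : (ι → ℝ) ≃L[ℝ] E) {η : E [⋀^Fin 2]→L[ℝ] ℝ} {χ : (ι → ℤ) → ℂ}

/-- **DECOMPOSABLE ⇒ THE THETA DIVISOR IS REDUCIBLE** (Cor. 3.23 (ii), «⇒» of "irreducible ⟺ `Θ`
irreducible", contrapositive; Grushevsky: "for a decomposable ppav `(A, Θ) = (A₁, Θ₁) × (A₂, Θ₂)` […]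
`Θ = (Θ₁ × A₂) ∪ (A₁ × Θ₂)`"). Let `(X = E/Λ, H)` be principally polarised and decomposable (a product
pair `(V, W)` of non-zero complex subtori, p16), `χ` a semicharacter and `ϑ ≢ 0` a canonical theta
function of `L(H, χ)`. Then `Θ = π({ϑ = 0}) ⊂ X` is NOT an irreducible analytic subset: along the addition
isomorphism `(X_V × X_W, H|_V ⊞ H|_W) ⥲ (X, H)` the function `ϑ` pulls back to `a · ϑ_V ⊠ ϑ_W` (Künneth
for the principal product polarisation, p04), whose divisor `(Θ_V × X_W) ∪ (X_V × Θ_W)` is reducible.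
[cite: ClemensGriffiths1972, §3 Cor. 3.23 (p. 297)] [cite: Grushevsky2012SchottkyProblem, §5]
[cite: Lange2023AbelianVarietiesComplex, §1.3.3 Lemma 1.3.6 and §2.4.4 Cor. 2.4.24] -/
theorem IsPrincipalPolarization.not_isIrreducibleAnalyticSet_thetaDivisor_of_isPolarizedDecomposable
    (hP : IsPrincipalPolarization Φ η) (hχ : IsSemicharacter Φ η χ) {ϑ : E → ℂ}
    (hϑ : ϑ ∈ thetaFunctions Φ (canonicalFactor Φ η χ)) (hϑ0 : ϑ ≠ 0) (hdec : IsPolarizedDecomposable Φ η) :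
    ¬ IsIrreducibleAnalyticSet 𝓘(ℂ, E) (cover Φ '' {w | ϑ w = 0}) := by
  intro hirr
  have hη : IsRiemannForm Φ η := hP.isRiemannForm
  obtain ⟨V, W, hV0, hW0, hp⟩ := hdec
  -- the factors `(X_V, H|_V)`, `(X_W, H|_W)`: principally polarised, of positive dimension
  set ΦV := subtorusPeriod Φ V hp.isLatticeSubspace_left hp.isComplexSubspace_left
  set ΦW := subtorusPeriod Φ W hp.isLatticeSubspace_right hp.isComplexSubspace_right
  set ηV : (cxSpan Φ V) [⋀^Fin 2]→L[ℝ] ℝ := pullbackForm (cxSpan Φ V).subtypeL η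
  set ηW : (cxSpan Φ W) [⋀^Fin 2]→L[ℝ] ℝ := pullbackForm (cxSpan Φ W).subtypeL η
  obtain ⟨_, _, hPV, -⟩ := (hP.isProductPair_iff_isPrincipalPolarization_restrict Φ).1 hp
  obtain ⟨_, _, hPW, -⟩ := (hP.isProductPair_iff_isPrincipalPolarization_restrict Φ).1 hp.symm
  haveI : Nontrivial (cxSpan Φ V) := Module.nontrivial_of_finrank_pos
    (finrank_cxSpan_pos Φ hp.isLatticeSubspace_left hp.isComplexSubspace_left hV0)
  haveI : Nontrivial (cxSpan Φ W) := Module.nontrivial_of_finrank_pos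
    (finrank_cxSpan_pos Φ hp.isLatticeSubspace_right hp.isComplexSubspace_right hW0)
  -- the addition isomorphism `h : X_V × X_W ⥲ X` and its representations `A`, `C`
  obtain ⟨hadd, hiso, -⟩ := hp.exists_isPolarizedIso_addition
  obtain ⟨A, B, C, -, -, hhA, -, hC, hform⟩ := hiso.exists_matrix
  -- `C^*η = η_V ⊞ η_W`
  have hpull : pullbackForm (C : (cxSpan Φ V × cxSpan Φ W) →L[ℂ] E) η = prodForm ηV ηW := by
    ext x
    have hx : x = ![x 0, x 1] := by funext i; fin_cases i <;> rfl
    rw [hx, pullbackForm_apply]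
    exact hform (x 0) (x 1)
  -- the pulled-back theta function `θ = ϑ ∘ C` of type `(η_V ⊞ η_W, ψ)`, `ψ = χ ∘ A`
  set ψ : (Fin (subRank V) ⊕ Fin (subRank W) → ℤ) → ℂ := fun m ↦ χ (A.mulVec m) with hψdef
  have hψ : IsSemicharacter (prodPeriod ΦV ΦW) (prodForm ηV ηW) ψ := by
    have := hχ.pullback (prodPeriod ΦV ΦW) Φ (F := (C : (cxSpan Φ V × cxSpan Φ W) →L[ℂ] E)) hC
    rwa [hpull] at this
  have hθ : ϑ ∘ (C : (cxSpan Φ V × cxSpan Φ W) →L[ℂ] E) ∈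
      thetaFunctions (prodPeriod ΦV ΦW) (canonicalFactor (prodPeriod ΦV ΦW) (prodForm ηV ηW) ψ) := by
    have h1 := comp_mem_thetaFunctions (prodPeriod ΦV ΦW) Φ
      (F := (C : (cxSpan Φ V × cxSpan Φ W) →L[ℂ] E)) hC hϑ
    have hfac : (fun n w ↦ canonicalFactor Φ η χ (A.mulVec n)
        ((C : (cxSpan Φ V × cxSpan Φ W) →L[ℂ] E) w)) =
        canonicalFactor (prodPeriod ΦV ΦW) (prodForm ηV ηW) ψ := by
      funext n w
      rw [← hpull, hψdef]
      exact (canonicalFactor_pullback (prodPeriod ΦV ΦW) Φ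
        (F := (C : (cxSpan Φ V × cxSpan Φ W) →L[ℂ] E)) hC η χ n w).symm
    rwa [hfac] at h1
  -- `ψ = ψ_V ⊠ ψ_W`; canonical theta functions `ϑ_V`, `ϑ_W` of the principal factors
  have hψV := hψ.inl ΦV ΦW
  have hψW := hψ.inr ΦV ΦW
  obtain ⟨ϑV, hϑV, hV1⟩ := exists_thetaFunction_ne_zero_of_isPrincipalPolarization ΦV hPV hψV
  obtain ⟨ϑW, hϑW, hW1⟩ := exists_thetaFunction_ne_zero_of_isPrincipalPolarization ΦW hPW hψW
  have hθ' : ϑ ∘ (C : (cxSpan Φ V × cxSpan Φ W) →L[ℂ] E) ∈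
      thetaFunctions (prodPeriod ΦV ΦW) (canonicalFactor (prodPeriod ΦV ΦW) (prodForm ηV ηW)
        (fun m ↦ (fun n ↦ ψ (Sum.elim n 0)) (fun i ↦ m (Sum.inl i)) *
          (fun n ↦ ψ (Sum.elim 0 n)) (fun j ↦ m (Sum.inr j)))) := by
    rw [← hψ.eq_boxProd ΦV ΦW]
    exact hθ
  -- Künneth for the principal product: `ϑ ∘ C = a · ϑ_V ⊠ ϑ_W`, `a ≠ 0`
  obtain ⟨a, ha⟩ := hPV.exists_eq_smul_boxMul hPW hψV hψW hϑV hV1 hϑW hW1 hθ'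
  have ha0 : a ≠ 0 := by
    rintro rfl
    apply hϑ0
    funext v
    obtain ⟨x, rfl⟩ := C.surjective v
    have := congr_fun ha x
    simpa using this
  -- `h⁻¹(Θ) = π_{V×W}({ϑ_V ⊠ ϑ_W = 0})` (both zero sets are lattice-saturated)
  have hsat := cover_preimage_image_zeroSet (isFactor_canonicalFactor Φ hη.isNSForm hχ) hϑ
  have hP12 := hPV.prod hPW
  have hbox := hψV.boxProd hψW
  have hbm := boxMul_mem_thetaFunctions_canonicalFactor ΦV ΦW ηV ηW hϑV hϑW
  have hfacP := isFactor_canonicalFactor (prodPeriod ΦV ΦW) hP12.isRiemannForm.isNSForm hbox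
  have hsatP := cover_preimage_image_zeroSet hfacP hbm
  have hset : hadd ⁻¹' (cover Φ '' {w | ϑ w = 0}) =
      cover (prodPeriod ΦV ΦW) '' ((fun v : cxSpan Φ V × cxSpan Φ W ↦ ϑV v.1 * ϑW v.2) ⁻¹' {0}) := by
    have hzero : ∀ x : cxSpan Φ V × cxSpan Φ W,
        ϑ ((C : (cxSpan Φ V × cxSpan Φ W) →L[ℂ] E) x) = 0 ↔ ϑV x.1 * ϑW x.2 = 0 := fun x ↦ by
      have hx := congr_fun ha x
      simp only [Function.comp_apply, Pi.smul_apply, smul_eq_mul] at hx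
      rw [hx, mul_eq_zero, or_iff_right ha0]
    have hcov : ∀ x : cxSpan Φ V × cxSpan Φ W,
        hadd (cover (prodPeriod ΦV ΦW) x) = cover Φ ((C : (cxSpan Φ V × cxSpan Φ W) →L[ℂ] E) x) :=
      fun x ↦ by rw [hhA, ← cover_apply_eq_mapMatrix_cover (L := (C : (cxSpan Φ V × cxSpan Φ W) →L[ℂ] E)) hC x]
    ext t
    obtain ⟨x, rfl⟩ := cover_surjective (prodPeriod ΦV ΦW) t
    have h1 : cover (prodPeriod ΦV ΦW) x ∈ hadd ⁻¹' (cover Φ '' {w | ϑ w = 0}) ↔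
        ϑ ((C : (cxSpan Φ V × cxSpan Φ W) →L[ℂ] E) x) = 0 := by
      rw [mem_preimage, hcov]
      change (C : (cxSpan Φ V × cxSpan Φ W) →L[ℂ] E) x ∈ cover Φ ⁻¹' (cover Φ '' (ϑ ⁻¹' {0})) ↔ _
      rw [hsat]
      rfl
    have h2 : cover (prodPeriod ΦV ΦW) x ∈
        cover (prodPeriod ΦV ΦW) '' ((fun v : cxSpan Φ V × cxSpan Φ W ↦ ϑV v.1 * ϑW v.2) ⁻¹' {0}) ↔
        ϑV x.1 * ϑW x.2 = 0 := by
      change x ∈ cover (prodPeriod ΦV ΦW) ⁻¹' (cover (prodPeriod ΦV ΦW) ''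
        ((fun v : cxSpan Φ V × cxSpan Φ W ↦ ϑV v.1 * ϑW v.2) ⁻¹' {0})) ↔ _
      rw [hsatP]
      rfl
    rw [h1, h2, hzero]
  -- transport irreducibility along `h` and contradict p04
  let hh : ComplexTorus (prodPeriod ΦV ΦW) ≃ₜ ComplexTorus Φ :=
    { toEquiv := hadd.toEquiv
      continuous_toFun := hiso.1.continuous
      continuous_invFun := hiso.2.1.continuous }
  have hirr' := IsIrreducibleAnalyticSet.preimage_homeomorph' (I := 𝓘(ℂ, cxSpan Φ V × cxSpan Φ W))
    (I' := 𝓘(ℂ, E)) hh (hiso.1.mdifferentiable (by simp)) (hiso.2.1.mdifferentiable (by simp)) hirr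
  have hpre : (hh : ComplexTorus (prodPeriod ΦV ΦW) → ComplexTorus Φ) ⁻¹' (cover Φ '' {w | ϑ w = 0}) =
      hadd ⁻¹' (cover Φ '' {w | ϑ w = 0}) := rfl
  rw [hpre, hset] at hirr'
  exact not_isIrreducibleAnalyticSet_image_zeroSet_boxMul ΦV ΦW (hp.isRiemannForm_left Φ hη)
    (hp.isRiemannForm_right Φ hη) hψV hψW hϑV hV1 hϑW hW1 hirr'

end Decomposable

/-! ### §3 The equivalences: Clemens–Griffiths Cor. 3.23 (ii) -/

section Equivalence

variable {ι : Type*} [Fintype ι] [DecidableEq ι] {E : Type u} [NormedAddCommGroup E]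
  [InnerProductSpace ℂ E] [FiniteDimensional ℂ E] [MeasurableSpace E] [BorelSpace E]
  (Φ : (ι → ℝ) ≃L[ℝ] E) {η : E [⋀^Fin 2]→L[ℝ] ℝ} {χ : (ι → ℤ) → ℂ}

include Φ in
omit [DecidableEq ι] [MeasurableSpace E] [BorelSpace E] in
/-- `2 (dim_ℂ E - 1) + 2 = |ι|` for a torus of positive dimension. [cite: Lange2023AbelianVarietiesComplex, §1.1.1] -/
private theorem two_mul_pred_add_two_eq_card' [Nontrivial E] :
    2 * (finrank ℂ E - 1) + 2 = Fintype.card ι := by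
  have h := finrank_complex_mul_two Φ (Fintype.equivFin ι).symm
  have h1 : 0 < finrank ℂ E := finrank_pos
  omega

/-- **`(X, H)` IS DECOMPOSABLE IFF ITS THETA DIVISOR IS REDUCIBLE.** For `(X = E/Λ, H)` principally
polarised of positive dimension, `χ` a semicharacter and `ϑ ≢ 0` a canonical theta function of `L(H, χ)`
with theta divisor `Θ = π({ϑ = 0})` (a reduced hypersurface, A2-121): `(X, H)` is a product of two
principally polarised abelian varieties of positive dimension (`IsPolarizedDecomposable`, p16) iff `Θ` is
not an irreducible analytic subset of `X` («⇐»: A2-122, Lange's Thm. 2.2.1; «⇒»: §2).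
[cite: ClemensGriffiths1972, §3 Cor. 3.23 (p. 297)] [cite: Lange2023AbelianVarietiesComplex, §2.2.1 Thm. 2.2.1] -/
theorem IsPrincipalPolarization.isPolarizedDecomposable_iff_not_isIrreducibleAnalyticSet_thetaDivisor
    [Nontrivial E] (hP : IsPrincipalPolarization Φ η) (hχ : IsSemicharacter Φ η χ) {ϑ : E → ℂ}
    (hϑ : ϑ ∈ thetaFunctions Φ (canonicalFactor Φ η χ)) (hϑ0 : ϑ ≠ 0) :
    IsPolarizedDecomposable Φ η ↔ ¬ IsIrreducibleAnalyticSet 𝓘(ℂ, E) (cover Φ '' {w | ϑ w = 0}) := by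
  refine ⟨hP.not_isIrreducibleAnalyticSet_thetaDivisor_of_isPolarizedDecomposable Φ hχ hϑ hϑ0,
    fun hirr ↦ ?_⟩
  have hcard := two_mul_pred_add_two_eq_card' (ι := ι) Φ
  have hd : (finrank ℂ E - 1) + 1 = finrank ℂ E := by have := finrank_pos (R := ℂ) (M := E); omega
  obtain ⟨Y, hY, hYz, -⟩ := hP.exists_hasPureDim_thetaDivisor Φ hχ hϑ hϑ0 hd
  have hYeq : cover Φ '' {w | ϑ w = 0} = Y := by
    rw [← hYz, image_preimage_eq _ (cover_surjective Φ)]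
  rw [hYeq] at hirr
  exact hP.isPolarizedDecomposable_of_not_isIrreducibleAnalyticSet Φ hcard hχ hϑ (Fintype.equivFin ι).symm
    hY hYz hirr

/-- **CLEMENS–GRIFFITHS, COROLLARY 3.23 (ii): "`𝒯` itself is irreducible if and only if `Θ(𝒯)` is
irreducible."** For a principally polarised abelian variety `𝒯 = (X = E/Λ, H)` of positive dimension (any
presentation `Φ`), `χ` a semicharacter and `ϑ ≢ 0` a canonical theta function of `L(H, χ)` with theta divisor
`Θ(𝒯) = π({ϑ = 0})`: `𝒯` is irreducible in the sense of Definition 3.22 (p26's `IsPolarizedIrreducible`: every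
morphism of principally polarised tori into `𝒯` is `0` or an isomorphism) iff `Θ(𝒯)` is an irreducible
analytic subset of `X`. (First assertion of Cor. 3.23: p26's `IsPrincipalPolarization.clemensGriffiths_3_23`.)
[cite: ClemensGriffiths1972, §3 Def. 3.22 and Cor. 3.23 (p. 297)] -/
theorem IsPrincipalPolarization.isPolarizedIrreducible_iff_isIrreducibleAnalyticSet_thetaDivisor
    [Nontrivial E] (hP : IsPrincipalPolarization Φ η) (hχ : IsSemicharacter Φ η χ) {ϑ : E → ℂ}
    (hϑ : ϑ ∈ thetaFunctions Φ (canonicalFactor Φ η χ)) (hϑ0 : ϑ ≠ 0) :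
    IsPolarizedIrreducible Φ η ↔ IsIrreducibleAnalyticSet 𝓘(ℂ, E) (cover Φ '' {w | ϑ w = 0}) := by
  have h1 : |polarizationDegree Φ η| = 1 := by rw [hP.polarizationDegree_eq_one, abs_one]
  rw [isPolarizedIrreducible_iff_not_isPolarizedDecomposable_of_abs_polarizationDegree Φ
      hP.isRiemannForm.isNSForm.type_one_one (fun m n ↦ hP.isRiemannForm.isNSForm.integral m n) h1,
    hP.isPolarizedDecomposable_iff_not_isIrreducibleAnalyticSet_thetaDivisor Φ hχ hϑ hϑ0, not_not]

end Equivalence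

end ComplexTorus

end Literature.Geometry.Kaehler

end
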